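/-
Copyright (c) 2026 the pub-hodgecm-mathlib formalisation cell (harness21).  Prover seat hodgecm-mathlib-LH4-p09 (g8), req620 Track A «(D-RAM) FOUR-FRAME» squad
(heir dealer LH4-plan (g13) WORD #83 ∕ #87: (d) cells — the ∀-closed G3 cell that LH4-p12 (g7)'s ★ p860329 consumes as `hG3`).  2026-09-04.
-/
import Summits.HodgeConjecture.HodgeConjecture.Theorems.F0P3cDyRamLevLabelledCellsGluedThree            -- ★ p860260 (this seat): `cell_G3` (wide fence)
import Summits.HodgeConjecture.HodgeConjecture.Theorems.F0P3cDyRamDiagonalKappaCoreHangingClass        -- ★ (LH4-p05): `two_le_d_of_v_two_lt_one`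
import HarnessLib

/-!
# (D-RAM) four-frame, STAGE 1b — (d) CELLS: the ∀-CLOSED G3 CELL AT A SCHEDULE `(la d, lb d)` — the `hG3` binder of LH4-p12 (g7)'s ★ p860329
# `kappaSignCount2_typeZero_lev_at_of_boxSum ∕ dyadicFence_levKappaSignLawAtS2_at_of_boxSum` DISCHARGED from ★ p860260 `cell_G3`

Helper brick for dealer LH4-plan (g13) WORD #83 ∕ #87 ((d) cells, this seat): `Theorems/` only, statement-first, ★-only imports, lane `--supports stmt-HodgeConjecture-24833 --as helper`;
PAYS NO tier-0 row (count-neutral).  ★ p860329's `hG3` hands the cell `hD, h2, hE` (at `N₀ d`), the fence `2d ≤ nᵢ+1`, `T, hT, i, f₂, hσf₂, hf₂`, `ρ, s`; `cell_G3` wants in addition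
`2 ≤ d` (★ `two_le_d_of_v_two_lt_one`), `d ≤ N₀ d` (`hN₀`), `la d ≤ 2` (`hla`), and the two level bounds `lb d ≤ nᵢ + la d`, `lb d ≤ nᵢ + nᵢ % 2` — both from p12's NARROW
schedule hypothesis `hlb : 2d ≤ n+1 → n % 2 = d % 2 → lb d ≤ n` and the depth parity ★ `depth_mod_two_eq_of_isElementDatum`; a WIDE twin `…_of_wide` takes instead
`hlbw : 2d ≤ n+1 → n % 2 = d % 2 → lb d ≤ n + la d ∧ lb d ≤ n + n % 2` (the odd-`d` `m*` rows).
* **`levG3Cell_of_schedule`** : ★ p860329's `hG3` type VERBATIM, from `(N₀ la lb) (hN₀) (hla) (hlb)`.   * **`levG3Cell_of_schedule_wide`** : the same from `hlbw`.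

HONEST LABEL: helper cells for HYPOTHESES; the lev law heads of ★ p860329 stay conditional on `hbox` (F0P3a-p01 (g36)'s (c)) and the dictionary; STAGE-1b tier-0 rows and the
ED. 5∕6∕7 law stubs stay OPEN; HC_CM is proved only modulo the 7 printed citations (2 remaining named inputs: hLiu418 = `stmt-HodgeConjecture-24832`, h413 = `stmt-HodgeConjecture-24833`)
until rung 0 closes.

## References
* [Kottwitz1986BaseChangeUnits] R. E. Kottwitz, *Base change for unit elements of Hecke algebras*, Compositio Math. 60 (1986), §1 pp. 240–241 (κ-orbital integrals of units as signed lattice counts).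
* [Rogawski1990] J. D. Rogawski, *Automorphic Representations of Unitary Groups in Three Variables*, Ann. of Math. Stud. 123 (1990), §4.9 Prop. 4.9.1 (a)(b) p. 55.
-/

set_option autoImplicit false

noncomputable section

namespace Summit.HodgeConjecture.HodgeConjecture.Cruxes.H413.F0P3cDyRamLevLabelledCellG3Closed

open Matrix WithZero
open Literature.NumberTheory.Automorphic Literature.NumberTheory.Automorphic.HermitianLattice Literature.NumberTheory.Automorphic.UnitaryGroup
open Literature.NumberTheory.Automorphic.UnitaryLatticeTree Literature.NumberTheory.Automorphic.UnitaryThreeFourFrame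
open Literature.NumberTheory.LocalFields.WildQuadraticDatum
open Summit.HodgeConjecture.HodgeConjecture.Cruxes.H413.F0P3cDyRamDiagonalTorusDefs
open Summit.HodgeConjecture.HodgeConjecture.Cruxes.H413.F0P3cDyRamDiagonalStrataDefs
open Summit.HodgeConjecture.HodgeConjecture.Cruxes.H413.F0P3cDyRamDiagonalKappaCountDefs
open Summit.HodgeConjecture.HodgeConjecture.Cruxes.H413.F0P3cDyRamElementDatumParity (depth_mod_two_eq_of_isElementDatum)
open Summit.HodgeConjecture.HodgeConjecture.Cruxes.H413.F0P3cDyRamDiagonalKappaCoreHangingClass (two_le_d_of_v_two_lt_one)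
open Summit.HodgeConjecture.HodgeConjecture.Cruxes.H413.F0P3cDyRamFourFrameCensusDefs
open Summit.HodgeConjecture.HodgeConjecture.Cruxes.H413.F0P3cDyRamLevLabelledCellsGluedThree (cell_G3)
open scoped Valued WithZero Matrix MatrixGroups

/-- **THE ∀-CLOSED G3 CELL AT THE SCHEDULE `(la d, lb d)`** — ★ p860329's `hG3` binder token for token — from ★ p860260 `cell_G3` under p12's narrow schedule bound
`hlb : 2d ≤ n + 1 → n % 2 = d % 2 → lb d ≤ n`. [cite: Kottwitz1986BaseChangeUnits, §1 pp. 240–241] [cite: Rogawski1990, §4.9 Prop. 4.9.1 (a)(b) p. 55] -/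
theorem levG3Cell_of_schedule (N₀ la lb : ℕ → ℕ) (hN₀ : ∀ d, d ≤ N₀ d) (hla : ∀ d, la d ≤ 2)
    (hlb : ∀ {d n : ℕ}, 2 * d ≤ n + 1 → n % 2 = d % 2 → lb d ≤ n) :
    ∀ {K : Type} [Field K] [Valued K ℤᵐ⁰] [CompleteSpace K] [Fintype 𝓀[K]] {σ : K →+* K} {ϖ : K} {d t : ℕ}, IsRamifiedQuadraticDatum σ ϖ d t →
      Valued.v (2 : K) < 1 → ∀ {α β : K} {n₁ n₂ n₃ : ℕ}, IsElementDatum σ ϖ (N₀ d) α β n₁ n₂ n₃ → (2 * d ≤ n₁ + 1 ∧ 2 * d ≤ n₂ + 1 ∧ 2 * d ≤ n₃ + 1) →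
      ∀ (T : GL (Fin 3) K), (T : Matrix (Fin 3) (Fin 3) K) = Matrix.diagonal ![α, β, 1] → ∀ (i : Fin 3) {f₂ : K}, σ f₂ = f₂ →
      (n₂ = n₁ → n₂ ≤ n₃ → Valued.v (f₂ + (β * α⁻¹ - 1) / (α⁻¹ - 1)) ≤ Valued.v ϖ ^ (n₃ - d + 1)) →
      ∀ ρ s, 1 ≤ ρ → 1 ≤ s →
      ∑ᶠ M ∈ {M | M ∈ stratum σ ϖ T ![2 * ρ + s, 2 * ρ + s, 2 * ρ] ∧
          (LatticeInLevel ϖ (la d) (Matrix.diagonal ![α - 1, β - 1, 0]) M ∧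
            LatticeInLevel ϖ (lb d) (Matrix.diagonal ![(α - 1) * (α - 1), (β - 1) * (β - 1), 0]) M)},
          (kappaCount σ ϖ 0 i M : ℚ) * stabiliserWeight σ M =
        (if 2 ∣ s ∧ 2 * ρ ≤ min n₁ n₂ ∧ 2 * ρ + s ≤ n₃ ∧ 2 * ρ + la d ≤ n₂ ∧ 2 * ρ + s + la d ≤ n₃ ∧ 2 * ρ + lb d ≤ 2 * n₂ then
            (![0, 0, (normSign σ (-1 : K) : ℚ) * (Fintype.card 𝓀[K] : ℚ) ^ (2 * ρ + s / 2 - 1) *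
                ((if 2 * d ≤ s then (Fintype.card 𝓀[K] : ℚ) - 1 else 0) - (if s + 2 = 2 * d then 1 else 0))] : Fin 3 → ℚ) i
          else 0) +
        (if 2 ∣ s ∧ n₁ = n₂ ∧ n₃ = n₁ + s ∧ n₁ < 2 * ρ + la d ∧ la d + ρ ≤ n₁ ∧ la d + 2 * ρ - n₁ ≤ n₁ - d + 1 ∧ 2 * ρ + lb d ≤ 2 * n₁ then
            (![if 2 * d ≤ la d + 2 * ρ - n₁ + 1 then (normSign σ f₂ : ℚ) else 0,
               if 2 * d ≤ la d + 2 * ρ - n₁ + 1 then (normSign σ (-1 : K) : ℚ) * normSign σ f₂ * normSign σ (1 + f₂) else 0,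
               if 2 * d ≤ s + (la d + 2 * ρ - n₁ + 1) then (normSign σ (-1 : K) : ℚ) * normSign σ (1 + f₂) else 0] : Fin 3 → ℚ) i *
              (Fintype.card 𝓀[K] : ℚ) ^ (2 * ρ + s / 2 - (la d + 2 * ρ - n₁ + 1) / 2)
          else 0) := by
  intro K _ _ _ _ σ ϖ d t hD h2 α β n₁ n₂ n₃ hE hfence T hT i f₂ hσf₂ hf₂ ρ s hρ hs
  have hd2 : 2 ≤ d := two_le_d_of_v_two_lt_one hD h2
  obtain ⟨hp1, hp2, hp3⟩ := depth_mod_two_eq_of_isElementDatum hD hE (hN₀ d)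
  have hl1 := hlb hfence.1 hp1
  have hl2 := hlb hfence.2.1 hp2
  have hl3 := hlb hfence.2.2 hp3
  exact cell_G3 hD h2 hE (hN₀ d) hT hd2 hfence (hla d) ⟨by omega, by omega, by omega⟩ ⟨by omega, by omega, by omega⟩ ρ s hρ hs i f₂ hσf₂ hf₂

/-- **THE SAME ON THE WIDE SCHEDULE BOUND** `hlbw : 2d ≤ n + 1 → n % 2 = d % 2 → lb d ≤ n + la d ∧ lb d ≤ n + n % 2` (holds at the odd-`d` `m* = 2d` rows over odd `n ≥ 2d − 1`).
[cite: Kottwitz1986BaseChangeUnits, §1 pp. 240–241] [cite: Rogawski1990, §4.9 Prop. 4.9.1 (a)(b) p. 55] -/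
theorem levG3Cell_of_schedule_wide (N₀ la lb : ℕ → ℕ) (hN₀ : ∀ d, d ≤ N₀ d) (hla : ∀ d, la d ≤ 2)
    (hlbw : ∀ {d n : ℕ}, 2 * d ≤ n + 1 → n % 2 = d % 2 → lb d ≤ n + la d ∧ lb d ≤ n + n % 2) :
    ∀ {K : Type} [Field K] [Valued K ℤᵐ⁰] [CompleteSpace K] [Fintype 𝓀[K]] {σ : K →+* K} {ϖ : K} {d t : ℕ}, IsRamifiedQuadraticDatum σ ϖ d t →
      Valued.v (2 : K) < 1 → ∀ {α β : K} {n₁ n₂ n₃ : ℕ}, IsElementDatum σ ϖ (N₀ d) α β n₁ n₂ n₃ → (2 * d ≤ n₁ + 1 ∧ 2 * d ≤ n₂ + 1 ∧ 2 * d ≤ n₃ + 1) →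
      ∀ (T : GL (Fin 3) K), (T : Matrix (Fin 3) (Fin 3) K) = Matrix.diagonal ![α, β, 1] → ∀ (i : Fin 3) {f₂ : K}, σ f₂ = f₂ →
      (n₂ = n₁ → n₂ ≤ n₃ → Valued.v (f₂ + (β * α⁻¹ - 1) / (α⁻¹ - 1)) ≤ Valued.v ϖ ^ (n₃ - d + 1)) →
      ∀ ρ s, 1 ≤ ρ → 1 ≤ s →
      ∑ᶠ M ∈ {M | M ∈ stratum σ ϖ T ![2 * ρ + s, 2 * ρ + s, 2 * ρ] ∧
          (LatticeInLevel ϖ (la d) (Matrix.diagonal ![α - 1, β - 1, 0]) M ∧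
            LatticeInLevel ϖ (lb d) (Matrix.diagonal ![(α - 1) * (α - 1), (β - 1) * (β - 1), 0]) M)},
          (kappaCount σ ϖ 0 i M : ℚ) * stabiliserWeight σ M =
        (if 2 ∣ s ∧ 2 * ρ ≤ min n₁ n₂ ∧ 2 * ρ + s ≤ n₃ ∧ 2 * ρ + la d ≤ n₂ ∧ 2 * ρ + s + la d ≤ n₃ ∧ 2 * ρ + lb d ≤ 2 * n₂ then
            (![0, 0, (normSign σ (-1 : K) : ℚ) * (Fintype.card 𝓀[K] : ℚ) ^ (2 * ρ + s / 2 - 1) *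
                ((if 2 * d ≤ s then (Fintype.card 𝓀[K] : ℚ) - 1 else 0) - (if s + 2 = 2 * d then 1 else 0))] : Fin 3 → ℚ) i
          else 0) +
        (if 2 ∣ s ∧ n₁ = n₂ ∧ n₃ = n₁ + s ∧ n₁ < 2 * ρ + la d ∧ la d + ρ ≤ n₁ ∧ la d + 2 * ρ - n₁ ≤ n₁ - d + 1 ∧ 2 * ρ + lb d ≤ 2 * n₁ then
            (![if 2 * d ≤ la d + 2 * ρ - n₁ + 1 then (normSign σ f₂ : ℚ) else 0,
               if 2 * d ≤ la d + 2 * ρ - n₁ + 1 then (normSign σ (-1 : K) : ℚ) * normSign σ f₂ * normSign σ (1 + f₂) else 0,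
               if 2 * d ≤ s + (la d + 2 * ρ - n₁ + 1) then (normSign σ (-1 : K) : ℚ) * normSign σ (1 + f₂) else 0] : Fin 3 → ℚ) i *
              (Fintype.card 𝓀[K] : ℚ) ^ (2 * ρ + s / 2 - (la d + 2 * ρ - n₁ + 1) / 2)
          else 0) := by
  intro K _ _ _ _ σ ϖ d t hD h2 α β n₁ n₂ n₃ hE hfence T hT i f₂ hσf₂ hf₂ ρ s hρ hs
  have hd2 : 2 ≤ d := two_le_d_of_v_two_lt_one hD h2
  obtain ⟨hp1, hp2, hp3⟩ := depth_mod_two_eq_of_isElementDatum hD hE (hN₀ d)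
  have hl1 := hlbw hfence.1 hp1
  have hl2 := hlbw hfence.2.1 hp2
  have hl3 := hlbw hfence.2.2 hp3
  exact cell_G3 hD h2 hE (hN₀ d) hT hd2 hfence (hla d) ⟨hl1.1, hl2.1, hl3.1⟩ ⟨hl1.2, hl2.2, hl3.2⟩ ρ s hρ hs i f₂ hσf₂ hf₂

end Summit.HodgeConjecture.HodgeConjecture.Cruxes.H413.F0P3cDyRamLevLabelledCellG3Closed

end
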